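import Mathlib.Analysis.CStarAlgebra.Matrix
import Mathlib.Analysis.SpecialFunctions.Trigonometric.Basic
import Mathlib.LinearAlgebra.UnitaryGroup
import Literature.Computability.QuantumComplexity.JonesPolynomial
import Literature.Computability.Cryptography.QubitRegister
import HarnessLib

/-!
# The Aharonov–Jones–Landau path-model representation on qubits

Topic `Literature/Computability/QuantumComplexity` (trunk T-CPLX-QUANT); sibling of
`JonesPolynomial.lean` (the Kauffman-bracket state sum `kauffmanBracketPlat`, `ajlPoint`,
`ajlLoopValue`, `ajlRatio`, `jonesApproxProblem`) and first layer of the decomposition of the named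
fact `ajl_jonesApproxProblem_mem_PromiseBQP` (`JonesInBQP.lean`; plan in `JonesInBQPProofs.lean`).

**Source.** D. Aharonov, V. Jones, Z. Landau, *A polynomial quantum algorithm for approximating
the Jones polynomial*, Algorithmica 55 (2009) 395–421 = arXiv:quant-ph/0511096 (held; the
numbering below is that of the arXiv text): §2.12 (path model representation of `TL_n(d)`,
Claims 2.4–2.6: `λ_ℓ = sin(πℓ/k)`, `d = 2cos(π/k)`), §2.13 (unitary path representation
`φ = τ ∘ ρ_A` of `B_n`, with §2.6 Def. 2.6 `ρ_A(σ_i) = A E_i + A⁻¹ I` and §2.7 Claim 2.2), §3.1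
("moving to qubits": paths as bit strings of steps, eq. (3.1), Claim 3.1), §3.3 (the algorithm:
Hadamard test on `|α⟩ = |1,0,1,0,…,1,0⟩`) and the proof of Thm. 3.2 with Claim 3.8
(`|α⟩⟨α| = Φ₁Φ₃⋯Φ_{n-1}/d^{n/2}`).

## Mathematical content

Fix `k` (the root of unity `e^{2πi/k}`) and put `λ_ℓ = sin(πℓ/k)` for `ℓ ∈ {1,…,k-1}`, `λ_ℓ = 0`
otherwise (AJL §3.1, "the convention `λ_j = 0` for any `j ∉ {1,..,k-1}`"). A bit string
`p ∈ {0,1}ⁿ` is read as a walk on the line graph `G_k` (vertices `1,…,k-1`) starting at vertex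
`1`, bit `1` = one step to the right, bit `0` = one step to the left; `P_{n,k}` is the set of
strings whose walk stays inside `G_k` (`IsGkPath`). For a generator index `i` (0-indexed here:
the tree's braid generator `i : Fin (n-1)` acts on strands `i, i+1`, i.e. it is AJL's
`E_{i+1}`/`σ_{i+1}`, and acts on the bits `i, i+1` of `p`), with `z` the vertex reached before
bit `i`, AJL eq. (3.1) reads

`Φ_i |p…01…⟩ = (λ_{z-1}/λ_z) |p…01…⟩ + (√(λ_{z+1}λ_{z-1})/λ_z) |p…10…⟩`,
`Φ_i |p…10…⟩ = (λ_{z+1}/λ_z) |p…10…⟩ + (√(λ_{z+1}λ_{z-1})/λ_z) |p…01…⟩`,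
`Φ_i |p…00…⟩ = Φ_i |p…11…⟩ = 0`,

i.e. the `(q, p)` entry is `√(λ_{z±1} λ_{z±1})/λ_z` with the two signs given by bit `i` of `p`
and of `q`, whenever `p, q ∈ P_{n,k}` agree off the bits `i, i+1` and both have unequal bits
there, and `0` otherwise (`ajlPhi`; we extend by `0`, not by the identity, outside `P_{n,k}` —
AJL extend `φ_i` "arbitrarily"; with the zero extension the algebraic identities below hold on
the whole register). The crossing matrices are `ρ_A`: `A Φ_i + A⁻¹ 1` for `σ_i` and
`A⁻¹ Φ_i + A 1` for `σ_i⁻¹` at `A = A_k = i e^{-iπ/2k}` (`ajlCrossingMatrix`, with the tree's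
`crossingWeight`), a braid word acts by the ordered product (`ajlBraidMatrixFn`,
`ajlBraidMatrix`), and `|α⟩ = |1,0,1,0,…⟩` (`ajlAlpha`).

**Proved here** (the linear algebra of AJL §2.12–§3.1 for these explicit matrices): the
eigenvector identity `λ_{z-1} + λ_{z+1} = d λ_z`, `d = 2cos(π/k)` (Claim 2.6); `d = -A_k² - A_k⁻²`
and `|A_k| = 1` (§2.13); **Claim 3.1** in the part that is used: `Φ_iᵀ = Φ_i` (Hermiticity,
Claim 2.5) and `Φ_i² = d Φ_i` (Claim 2.4) — the remaining Temperley–Lieb relations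
`Φ_i Φ_{i±1} Φ_i = Φ_i`, `Φ_i Φ_j = Φ_j Φ_i` (`|i - j| ≥ 2`) of Claim 3.1 are not needed below and
are not recorded; **Claims 2.2/3.1**: every crossing matrix, hence every `φ(w)`, is unitary
(`ajlCrossingMatrix_mem_unitaryGroup`, `ajlBraidMatrixFn_mem_unitaryGroup`), so all its entries
have modulus `≤ 1`; **Claim 3.8**: `Φ₀ Φ₂ ⋯ Φ_{n-2} = d^{n/2} |α⟩⟨α|` (`ajl_claim38`).

**Named fact** (D-0014, not discharged here): `ajl_thm32_matrixElement`,
`⟨α| φ(w) |α⟩ = ⟨w^{pl}⟩(A_k) / d^{n/2-1}` — the identity in the proof of Thm. 3.2 (AJL derive it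
from the Markov trace: Lemma 2.2, Claims 3.6 and 3.8, uniqueness Lemma 2.1, and `TL_n ≅ gTL_n`,
Thm. 2.1; here `⟨·⟩` is the tree's state sum `kauffmanBracketPlat`, whose loop number `|σ|` is a
connected-component count, so a tree proof is a link-state induction over the slices of the
diagram plus the matching recursion for `loopCount`). Its proved consequences:
`ajlRatio k n b = |⟨α|φ(b)|α⟩| ≤ 1` (`ajlRatio_eq_norm_of_thm32`, `ajlRatio_le_one_of_thm32`) —
the quantity estimated by the Hadamard test of Algorithm Approximate-Jones-Plat-Closure (§3.3).

## Conventions, cross-checked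

All four facts were checked numerically against the tree's exact combinatorial definitions
(`smoothingRel`/`loopCount`/`kauffmanBracketPlat` of `JonesPolynomial.lean`, union–find on the
diagram points) for `k ∈ {3,…,7}`, `n ∈ {2,4,6}`, all words of length `≤ 4` sampled and all
smoothing states: generator `i` ↔ bits `i, i+1`; `α_t = [t even]`; the `(α, α)` entry does not
depend on the order of the product (each crossing matrix is complex symmetric, so reversing the
word transposes the product).

## References

* D. Aharonov, V. Jones, Z. Landau, Algorithmica 55 (2009) 395–421; arXiv:quant-ph/0511096,
  §2.6 Def. 2.6, §2.7 Claim 2.2, §2.12 Claims 2.4–2.6, §2.13 Def. 2.14, §3.1 eq. (3.1) and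
  Claim 3.1, §3.3, Thm. 3.2 with Claim 3.8 [AharonovJonesLandau2009].
* V. F. R. Jones, *Index for subfactors*, Invent. Math. 72 (1983) (path/Markov trace);
  L. H. Kauffman, *State models and the Jones polynomial*, Topology 26 (1987).
-/

noncomputable section

open Matrix Complex Finset

namespace Literature.Computability.QuantumComplexity

variable {n : ℕ}

/-! ### Weights, walks on `G_k`, and the generators `Φ_i` (AJL §3.1) -/

/-- The AJL weights `λ_ℓ = sin(πℓ/k)` for `ℓ ∈ {1,…,k-1}` and `λ_ℓ = 0` otherwise (the
Perron–Frobenius eigenvector of the line graph `G_k`). [cite: AharonovJonesLandau2009, Claim 2.6 and §3.1] -/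
def ajlWeight (k : ℕ) (ℓ : ℤ) : ℝ :=
  if 1 ≤ ℓ ∧ ℓ + 1 ≤ k then Real.sin (Real.pi * ℓ / k) else 0

/-- The step `±1` encoded by a bit: `1` (`true`) = one step to the right, `0` = to the left.
[cite: AharonovJonesLandau2009, §3.1] -/
def stepSign (b : Bool) : ℤ := if b then 1 else -1

/-- The vertex of `G_k` reached by the walk `p` after its first `j` steps, starting at vertex `1`
(`z_i = ℓ(p|_i)` of AJL Def. 3.2 is `pathPos p i` with 0-indexed bits). [cite: AharonovJonesLandau2009, Def. 3.2] -/
def pathPos (p : Cryptography.QReg n) (j : ℕ) : ℤ :=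
  1 + ∑ t : Fin n, if (t : ℕ) < j then stepSign (p t) else 0

/-- `p ∈ P_{n,k}`: the walk of the bit string `p` stays inside `G_k = {1,…,k-1}` at all times.
[cite: AharonovJonesLandau2009, Def. 3.1] -/
def IsGkPath (k n : ℕ) (p : Cryptography.QReg n) : Prop :=
  ∀ j ≤ n, 1 ≤ pathPos p j ∧ pathPos p j + 1 ≤ k

/-- Membership in `P_{n,k}` is decidable (finitely many bounded conditions). [folklore] -/
instance (k n : ℕ) : DecidablePred (IsGkPath k n) := fun _ => by
  unfold IsGkPath; infer_instance

/-- The bit acted on first by generator `i : Fin (n-1)` (bit `i`). [folklore] -/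
def genFst (i : Fin (n - 1)) : Fin n := ⟨i, by omega⟩

/-- The second bit acted on by generator `i : Fin (n-1)` (bit `i+1`). [folklore] -/
def genSnd (i : Fin (n - 1)) : Fin n := ⟨i + 1, by omega⟩

/-- The support condition of the `(q, p)` entry of `Φ_i`: `p, q ∈ P_{n,k}` agree off the bits
`i, i+1` and both read `01` or `10` there. [cite: AharonovJonesLandau2009, §3.1 eq. (3.1)] -/
def PhiSupport (k n : ℕ) (i : Fin (n - 1)) (q p : Cryptography.QReg n) : Prop :=
  IsGkPath k n p ∧ IsGkPath k n q ∧ (∀ t : Fin n, t ≠ genFst i → t ≠ genSnd i → q t = p t) ∧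
    p (genFst i) ≠ p (genSnd i) ∧ q (genFst i) ≠ q (genSnd i)

/-- The support condition is decidable. [folklore] -/
instance (k n : ℕ) (i : Fin (n - 1)) (q p : Cryptography.QReg n) : Decidable (PhiSupport k n i q p) := by
  unfold PhiSupport; infer_instance

/-- **AJL eq. (3.1): the path-model generator `Φ_i = Φ(E_{i+1})` on `n`-bit strings** (0-indexed
`i : Fin (n-1)`, acting on bits `i, i+1`): entry `(q, p) = √(λ_{z+ε(p)} λ_{z+ε(q)}) / λ_z` with
`z` the vertex before bit `i` and `ε = ±1` the step of bit `i`, on the support `PhiSupport`, and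
`0` otherwise (zero extension outside `P_{n,k}`). [cite: AharonovJonesLandau2009, §3.1 eq. (3.1)] -/
def ajlPhi (k n : ℕ) (i : Fin (n - 1)) : Matrix (Cryptography.QReg n) (Cryptography.QReg n) ℝ :=
  Matrix.of fun q p =>
    if PhiSupport k n i q p then
      Real.sqrt (ajlWeight k (pathPos p i + stepSign (p (genFst i))) *
          ajlWeight k (pathPos p i + stepSign (q (genFst i)))) / ajlWeight k (pathPos p i)
    else 0

/-! ### Crossings, braid words, and the vector `|α⟩` (AJL §2.6, §2.13, §3.3) -/

/-- The unitary path-model matrix of one signed generator at `A = A_k = i e^{-iπ/2k}`: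
`ρ_A(σ_i) = A Φ_i + A⁻¹ 1`, `ρ_A(σ_i⁻¹) = A⁻¹ Φ_i + A 1` (coefficients = the tree's
`crossingWeight` of the capcup resp. identity smoothing). [cite: AharonovJonesLandau2009, Def. 2.6 and Def. 2.14] -/
def ajlCrossingMatrix (k : ℕ) {n : ℕ} (g : Fin (n - 1) × Bool) : Matrix (Cryptography.QReg n) (Cryptography.QReg n) ℂ :=
  crossingWeight (ajlPoint k) g.2 true • (ajlPhi k n g.1).map ((↑) : ℝ → ℂ) +
    crossingWeight (ajlPoint k) g.2 false • (1 : Matrix (Cryptography.QReg n) (Cryptography.QReg n) ℂ)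

/-- The path-model matrix `φ(w)` of an `m`-letter braid word `w` (ordered product, letter `0`
leftmost). [cite: AharonovJonesLandau2009, Def. 2.14 and Cor. 3.1] -/
def ajlBraidMatrixFn (k : ℕ) {n m : ℕ} (w : Fin m → Fin (n - 1) × Bool) :
    Matrix (Cryptography.QReg n) (Cryptography.QReg n) ℂ :=
  (List.ofFn fun j => ajlCrossingMatrix k (w j)).prod

/-- The path-model matrix `φ(b)` of a braid word `b : BraidWord n`. [cite: AharonovJonesLandau2009, Def. 2.14] -/
def ajlBraidMatrix (k : ℕ) {n : ℕ} (b : BraidWord n) : Matrix (Cryptography.QReg n) (Cryptography.QReg n) ℂ :=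
  ajlBraidMatrixFn k b.get

/-- The string `α = 1,0,1,0,…` (the zigzag walk `1,2,1,2,…`), start state of Algorithm
Approximate-Jones-Plat-Closure. [cite: AharonovJonesLandau2009, §3.3 and Claim 3.8] -/
def ajlAlpha (n : ℕ) : Cryptography.QReg n := fun t => decide (Even (t : ℕ))

/-- The rank-one matrix `|α⟩⟨α|`. [cite: AharonovJonesLandau2009, Claim 3.8] -/
def ajlAlphaProj (n : ℕ) : Matrix (Cryptography.QReg n) (Cryptography.QReg n) ℝ :=
  Matrix.of fun q p => if q = ajlAlpha n ∧ p = ajlAlpha n then 1 else 0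

/-! ### The matrix-element identity of Thm. 3.2, as a named fact -/

/-- **AJL Thm. 3.2 (the identity in its proof; Lemma 2.2, Claims 3.6, 3.8, Lemma 2.1):** for even
`n ≥ 2` and every braid word `w` with `m` crossings on `n` strands,
`⟨α| φ(w) |α⟩ = ⟨w^{pl}⟩(A_k) / d^{n/2-1}`, where `⟨·⟩` is the Kauffman bracket of the plat
closure (the tree's state sum `kauffmanBracketPlat`, loops counted as connected components) and
`d = 2cos(π/k)`. [cite: AharonovJonesLandau2009, Thm. 3.2 (proof) and Claim 3.8] -/
def ajl_thm32_matrixElement : Prop :=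
  ∀ (k n m : ℕ) (w : Fin m → Fin (n - 1) × Bool), 3 ≤ k → Even n → 2 ≤ n →
    ajlBraidMatrixFn k w (ajlAlpha n) (ajlAlpha n) =
      kauffmanBracketPlat (ajlPoint k) w / (ajlLoopValue k : ℂ) ^ (n / 2 - 1)

/-! ### Proved API -/

section Weights

/-- `λ_ℓ = 0` off `{1,…,k-1}`. [cite: AharonovJonesLandau2009, §3.1] -/
theorem ajlWeight_of_not {k : ℕ} {ℓ : ℤ} (h : ¬ (1 ≤ ℓ ∧ ℓ + 1 ≤ k)) : ajlWeight k ℓ = 0 := by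
  rw [ajlWeight, if_neg h]

/-- `λ_ℓ = sin(πℓ/k)` on `{1,…,k-1}`. [cite: AharonovJonesLandau2009, Claim 2.6] -/
theorem ajlWeight_of_mem {k : ℕ} {ℓ : ℤ} (h : 1 ≤ ℓ ∧ ℓ + 1 ≤ k) :
    ajlWeight k ℓ = Real.sin (Real.pi * ℓ / k) := by
  rw [ajlWeight, if_pos h]

/-- The sine formula also holds at the two boundary vertices `ℓ = 0` and `ℓ = k`
(`sin 0 = sin π = 0`), i.e. for all `0 ≤ ℓ ≤ k`. [cite: AharonovJonesLandau2009, Claim 2.6] -/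
theorem ajlWeight_eq_sin {k : ℕ} {ℓ : ℤ} (hk : 1 ≤ k) (h0 : 0 ≤ ℓ) (h1 : ℓ ≤ k) :
    ajlWeight k ℓ = Real.sin (Real.pi * ℓ / k) := by
  by_cases h : 1 ≤ ℓ ∧ ℓ + 1 ≤ k
  · exact ajlWeight_of_mem h
  · rw [ajlWeight_of_not h]
    rcases not_and_or.1 h with h' | h'
    · obtain rfl : ℓ = 0 := by omega
      simp
    · obtain rfl : ℓ = k := by omega
      have hk' : (k : ℝ) ≠ 0 := by exact_mod_cast (by omega : k ≠ 0)
      rw [Int.cast_natCast, mul_div_assoc, div_self hk', mul_one, Real.sin_pi]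

/-- The weights are nonnegative (`0 ≤ πℓ/k ≤ π`). [cite: AharonovJonesLandau2009, Claim 2.6] -/
theorem ajlWeight_nonneg (k : ℕ) (ℓ : ℤ) : 0 ≤ ajlWeight k ℓ := by
  by_cases h : 1 ≤ ℓ ∧ ℓ + 1 ≤ k
  · rw [ajlWeight_of_mem h]
    have hk : (0 : ℝ) < k := by exact_mod_cast (by omega : 0 < k)
    have hℓ : (0 : ℝ) ≤ ℓ := by exact_mod_cast (by omega : (0 : ℤ) ≤ ℓ)
    have hℓk : (ℓ : ℝ) ≤ k := by exact_mod_cast (by omega : ℓ ≤ (k : ℤ))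
    apply Real.sin_nonneg_of_nonneg_of_le_pi
    · positivity
    · rw [div_le_iff₀ hk]
      nlinarith [Real.pi_pos]
  · rw [ajlWeight_of_not h]

/-- **The eigenvector identity of Claim 2.6:** `λ_{z-1} + λ_{z+1} = d λ_z` for `z ∈ {1,…,k-1}`,
`d = 2cos(π/k)` (`sin(a-b) + sin(a+b) = 2 sin a cos b`, with `λ_0 = λ_k = 0`).
[cite: AharonovJonesLandau2009, Claim 2.6] -/
theorem ajlWeight_pred_add_succ {k : ℕ} {z : ℤ} (hz : 1 ≤ z ∧ z + 1 ≤ k) :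
    ajlWeight k (z - 1) + ajlWeight k (z + 1) = ajlLoopValue k * ajlWeight k z := by
  have hk : 1 ≤ k := by omega
  rw [ajlWeight_eq_sin hk (by omega) (by omega), ajlWeight_eq_sin hk (by omega) (by omega),
    ajlWeight_of_mem hz, ajlLoopValue]
  have hk' : (k : ℝ) ≠ 0 := by exact_mod_cast (by omega : k ≠ 0)
  have e1 : Real.pi * ((z - 1 : ℤ) : ℝ) / k = Real.pi * z / k - Real.pi / k := by
    push_cast; ring
  have e2 : Real.pi * ((z + 1 : ℤ) : ℝ) / k = Real.pi * z / k + Real.pi / k := by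
    push_cast; ring
  rw [e1, e2, ← Real.two_mul_sin_mul_cos]
  ring

end Weights

section Point

/-- `A_k² = -e^{-iπ/k}`. [cite: AharonovJonesLandau2009, §2.13] -/
theorem ajlPoint_sq (k : ℕ) : ajlPoint k ^ 2 = -exp (-(Real.pi / k : ℝ) * I) := by
  rw [ajlPoint, mul_pow, I_sq, neg_one_mul, sq, ← exp_add]
  congr 2
  push_cast
  ring

/-- `|A_k| = 1`. [cite: AharonovJonesLandau2009, §2.13] -/
theorem norm_ajlPoint (k : ℕ) : ‖ajlPoint k‖ = 1 := by
  rw [ajlPoint, norm_mul, norm_I, one_mul, ← ofReal_neg, norm_exp_ofReal_mul_I]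

/-- `A_k ≠ 0`. [cite: AharonovJonesLandau2009, §2.13] -/
theorem ajlPoint_ne_zero (k : ℕ) : ajlPoint k ≠ 0 := by
  intro h
  have := norm_ajlPoint k
  rw [h, norm_zero] at this
  exact zero_ne_one this

/-- `A_k⁻¹ = conj A_k` (`|A_k| = 1`). [cite: AharonovJonesLandau2009, §2.13] -/
theorem ajlPoint_inv (k : ℕ) : (ajlPoint k)⁻¹ = starRingEnd ℂ (ajlPoint k) := by
  rw [Complex.inv_def, normSq_eq_norm_sq, norm_ajlPoint]
  simp

/-- **`d = -A_k² - A_k⁻²` for `A_k = i e^{-iπ/2k}`, with `d = 2cos(π/k)`** (the tree's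
`loopValue (ajlPoint k) = ajlLoopValue k`). [cite: AharonovJonesLandau2009, §2.13 and §3 (proof of Thm. 1.1)] -/
theorem loopValue_ajlPoint (k : ℕ) : loopValue (ajlPoint k) = (ajlLoopValue k : ℂ) := by
  have h2 : (ajlPoint k)⁻¹ ^ 2 = -exp ((Real.pi / k : ℝ) * I) := by
    rw [inv_pow, ajlPoint_sq, inv_neg, ← exp_neg]
    congr 2
    ring
  rw [loopValue, h2, ajlPoint_sq, ajlLoopValue]
  push_cast
  rw [Complex.two_cos]
  ring

end Point

/-! ### Walk positions -/

section Walks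

/-- Bit `1` is a step `+1`. [folklore] -/
@[simp] theorem stepSign_true : stepSign true = 1 := rfl

/-- Bit `0` is a step `-1`. [folklore] -/
@[simp] theorem stepSign_false : stepSign false = -1 := rfl

/-- Negating a bit reverses the step. [folklore] -/
@[simp] theorem stepSign_not (b : Bool) : stepSign (!b) = -stepSign b := by
  cases b <;> simp [stepSign]

/-- Walks start at vertex `1`. [cite: AharonovJonesLandau2009, Def. 3.1] -/
@[simp] theorem pathPos_zero (p : Cryptography.QReg n) : pathPos p 0 = 1 := by
  simp [pathPos]

/-- One more step: `z_{j+1} = z_j ± 1` according to bit `j`. [cite: AharonovJonesLandau2009, Def. 3.2] -/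
theorem pathPos_succ (p : Cryptography.QReg n) {j : ℕ} (hj : j < n) :
    pathPos p (j + 1) = pathPos p j + stepSign (p ⟨j, hj⟩) := by
  have key : ∀ t : Fin n, (if (t : ℕ) < j + 1 then stepSign (p t) else 0) =
      (if (t : ℕ) < j then stepSign (p t) else 0) + (if t = ⟨j, hj⟩ then stepSign (p t) else 0) := by
    intro t
    by_cases h1 : (t : ℕ) < j
    · have h2 : t ≠ ⟨j, hj⟩ := fun e => by rw [e] at h1; exact lt_irrefl _ h1
      simp [h1, h2, Nat.lt_succ_of_lt h1]
    · by_cases h2 : t = ⟨j, hj⟩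
      · subst h2; simp
      · have h3 : ¬ (t : ℕ) < j + 1 := fun h => h2 (Fin.ext (by simp; omega))
        simp [h1, h2, h3]
  unfold pathPos
  simp_rw [key, Finset.sum_add_distrib, Finset.sum_ite_eq', Finset.mem_univ, if_true]
  ring

/-- Walks that agree on the first `j` bits are at the same vertex after `j` steps. [folklore] -/
theorem pathPos_eq_of_agree {p q : Cryptography.QReg n} {j : ℕ} (h : ∀ t : Fin n, (t : ℕ) < j → q t = p t) :
    pathPos q j = pathPos p j := by
  unfold pathPos
  congr 1
  refine Finset.sum_congr rfl fun t _ => ?_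
  by_cases ht : (t : ℕ) < j
  · rw [if_pos ht, if_pos ht, h t ht]
  · rw [if_neg ht, if_neg ht]

variable {k : ℕ} {i : Fin (n - 1)}

/-- `genFst i` is bit `i`. [folklore] -/
@[simp] theorem genFst_val (i : Fin (n - 1)) : (genFst i : ℕ) = i := rfl

/-- `genSnd i` is bit `i+1`. [folklore] -/
@[simp] theorem genSnd_val (i : Fin (n - 1)) : (genSnd i : ℕ) = i + 1 := rfl

/-- The two bits of a generator are distinct. [folklore] -/
theorem genFst_ne_genSnd (i : Fin (n - 1)) : genFst i ≠ genSnd i := by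
  simp [Fin.ext_iff]

/-- The string agreeing with `p` off the bits `i, i+1` and reading `b, ¬b` there. [folklore] -/
def flipTo (p : Cryptography.QReg n) (i : Fin (n - 1)) (b : Bool) : Cryptography.QReg n := fun t =>
  if t = genFst i then b else if t = genSnd i then !b else p t

/-- Bit `i` of the flip. [folklore] -/
@[simp] theorem flipTo_genFst (p : Cryptography.QReg n) (i : Fin (n - 1)) (b : Bool) :
    flipTo p i b (genFst i) = b := by
  simp [flipTo]

/-- Bit `i+1` of the flip. [folklore] -/
@[simp] theorem flipTo_genSnd (p : Cryptography.QReg n) (i : Fin (n - 1)) (b : Bool) :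
    flipTo p i b (genSnd i) = !b := by
  simp [flipTo, (genFst_ne_genSnd i).symm]

/-- The flip agrees with `p` off the bits `i, i+1`. [folklore] -/
theorem flipTo_of_ne (p : Cryptography.QReg n) (i : Fin (n - 1)) (b : Bool) {t : Fin n} (h1 : t ≠ genFst i)
    (h2 : t ≠ genSnd i) : flipTo p i b t = p t := by
  simp [flipTo, h1, h2]

/-- The two flips differ. [folklore] -/
theorem flipTo_true_ne_false (p : Cryptography.QReg n) (i : Fin (n - 1)) : flipTo p i true ≠ flipTo p i false := by
  intro h
  have := congr_fun h (genFst i)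
  simp at this

/-- A string in the support of column `p` of `Φ_i` is one of the two flips of `p`. [folklore] -/
theorem eq_flipTo_of_agree {p r : Cryptography.QReg n} (hagree : ∀ t : Fin n, t ≠ genFst i → t ≠ genSnd i → r t = p t)
    (hne : r (genFst i) ≠ r (genSnd i)) : r = flipTo p i (r (genFst i)) := by
  funext t
  by_cases h1 : t = genFst i
  · subst h1; simp
  · by_cases h2 : t = genSnd i
    · subst h2
      rw [flipTo_genSnd]
      cases h : r (genFst i) <;> cases h' : r (genSnd i) <;> simp_all
    · rw [flipTo_of_ne p i _ h1 h2, hagree t h1 h2]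

/-- Positions of a flip agree with those of `p` up to step `i`. [folklore] -/
theorem pathPos_flipTo_of_le (p : Cryptography.QReg n) (i : Fin (n - 1)) (b : Bool) {j : ℕ} (hj : j ≤ i) :
    pathPos (flipTo p i b) j = pathPos p j :=
  pathPos_eq_of_agree fun t ht =>
    flipTo_of_ne p i b (fun e => by rw [e] at ht; simp at ht; omega)
      (fun e => by rw [e] at ht; simp at ht; omega)

/-- Positions of a flip of a string reading `c, ¬c` at bits `i, i+1` agree with those of `p` from
step `i+2` on (the two steps cancel in both). [folklore] -/
theorem pathPos_flipTo_of_ge (p : Cryptography.QReg n) (i : Fin (n - 1)) (b : Bool)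
    (hp : p (genSnd i) = !p (genFst i)) {j : ℕ} (hj : (i : ℕ) + 2 ≤ j) :
    pathPos (flipTo p i b) j = pathPos p j := by
  have hi1 : (i : ℕ) < j := by omega
  have hi2 : (i : ℕ) + 1 < j := by omega
  unfold pathPos
  congr 1
  rw [← sub_eq_zero, ← Finset.sum_sub_distrib,
    Fintype.sum_eq_add (genFst i) (genSnd i) (genFst_ne_genSnd i)]
  · simp only [genFst_val, genSnd_val, hi1, hi2, if_true, flipTo_genFst, flipTo_genSnd, hp,
      stepSign_not]
    ring
  · rintro t ⟨h1, h2⟩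
    rw [flipTo_of_ne p i b h1 h2, sub_self]

/-- Validity gives the bounds at every step `j ≤ n`. [cite: AharonovJonesLandau2009, Def. 3.1] -/
theorem IsGkPath.bounds {p : Cryptography.QReg n} (h : IsGkPath k n p) {j : ℕ} (hj : j ≤ n) :
    1 ≤ pathPos p j ∧ pathPos p j + 1 ≤ k :=
  h j hj

/-- If `p ∈ P_{n,k}` reads `c, ¬c` at bits `i, i+1`, then the flip `flipTo p i b` is in
`P_{n,k}` as soon as its position `z + ε(b)` after bit `i` is a vertex of `G_k`. [folklore] -/
theorem isGkPath_flipTo {p : Cryptography.QReg n} (hp : IsGkPath k n p) (hc : p (genSnd i) = !p (genFst i))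
    (b : Bool) (hb : 1 ≤ pathPos p i + stepSign b ∧ pathPos p i + stepSign b + 1 ≤ k) :
    IsGkPath k n (flipTo p i b) := by
  intro j hj
  rcases Nat.lt_or_ge j (i + 1) with h | h
  · rw [pathPos_flipTo_of_le p i b (by omega)]
    exact hp j hj
  · rcases Nat.lt_or_ge j (i + 2) with h' | h'
    · obtain rfl : j = i + 1 := by omega
      have hi : (i : ℕ) < n := by omega
      rw [pathPos_succ _ hi, show (⟨i, hi⟩ : Fin n) = genFst i from rfl, flipTo_genFst,
        pathPos_flipTo_of_le p i b le_rfl]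
      exact hb
    · rw [pathPos_flipTo_of_ge p i b hc h']
      exact hp j hj

/-- Contrapositive form used in the computation of `Φ_i²`: an invalid flip has weight
`λ_{z+ε(b)} = 0`. [folklore] -/
theorem ajlWeight_eq_zero_of_not_isGkPath_flipTo {p : Cryptography.QReg n} (hp : IsGkPath k n p)
    (hc : p (genSnd i) = !p (genFst i)) {b : Bool} (hb : ¬ IsGkPath k n (flipTo p i b)) :
    ajlWeight k (pathPos p i + stepSign b) = 0 :=
  ajlWeight_of_not fun h => hb (isGkPath_flipTo hp hc b h)

end Walks

/-! ### Claim 3.1, first two conjuncts: `Φ_iᵀ = Φ_i` and `Φ_i² = d Φ_i` -/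

section Claim31

variable {k : ℕ} {i : Fin (n - 1)}

/-- The support condition is symmetric in `(q, p)`. [cite: AharonovJonesLandau2009, Claim 2.5] -/
theorem PhiSupport.symm {q p : Cryptography.QReg n} (h : PhiSupport k n i q p) : PhiSupport k n i p q :=
  ⟨h.2.1, h.1, fun t h1 h2 => (h.2.2.1 t h1 h2).symm, h.2.2.2.2, h.2.2.2.1⟩

/-- On the support both strings are at the same vertex `z` before bit `i`. [cite: AharonovJonesLandau2009, §3.1] -/
theorem PhiSupport.pathPos_eq {q p : Cryptography.QReg n} (h : PhiSupport k n i q p) :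
    pathPos q i = pathPos p i :=
  pathPos_eq_of_agree fun t ht =>
    h.2.2.1 t (fun e => by rw [e] at ht; simp at ht) (fun e => by rw [e] at ht; simp at ht)

/-- Entry formula of `Φ_i` (definitional). [cite: AharonovJonesLandau2009, §3.1 eq. (3.1)] -/
theorem ajlPhi_apply (k n : ℕ) (i : Fin (n - 1)) (q p : Cryptography.QReg n) :
    ajlPhi k n i q p = if PhiSupport k n i q p then
      Real.sqrt (ajlWeight k (pathPos p i + stepSign (p (genFst i))) *
          ajlWeight k (pathPos p i + stepSign (q (genFst i)))) / ajlWeight k (pathPos p i)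
      else 0 := rfl

/-- **AJL Claim 3.1, Hermiticity:** `Φ_i` is a real symmetric matrix. [cite: AharonovJonesLandau2009, Claim 3.1 (Claim 2.5)] -/
theorem ajlPhi_transpose (k n : ℕ) (i : Fin (n - 1)) : (ajlPhi k n i)ᵀ = ajlPhi k n i := by
  ext q p
  rw [transpose_apply, ajlPhi_apply, ajlPhi_apply]
  by_cases h : PhiSupport k n i q p
  · rw [if_pos h, if_pos h.symm, h.pathPos_eq, mul_comm]
  · rw [if_neg h, if_neg fun h' => h h'.symm]

/-- The weights are positive on `G_k`. [cite: AharonovJonesLandau2009, Claim 2.6] -/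
theorem ajlWeight_pos {ℓ : ℤ} (h : 1 ≤ ℓ ∧ ℓ + 1 ≤ k) : 0 < ajlWeight k ℓ := by
  rw [ajlWeight_of_mem h]
  have hk : (0 : ℝ) < k := by exact_mod_cast (by omega : 0 < k)
  have hℓ : (0 : ℝ) < ℓ := by exact_mod_cast (by omega : (0 : ℤ) < ℓ)
  have hℓk : (ℓ : ℝ) < k := by exact_mod_cast (by omega : ℓ < (k : ℤ))
  apply Real.sin_pos_of_pos_of_lt_pi
  · positivity
  · rw [div_lt_iff₀ hk]
    nlinarith [Real.pi_pos]

/-- In the support, bit `i+1` of `p` is the negation of bit `i`. [folklore] -/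
theorem PhiSupport.snd_eq {q p : Cryptography.QReg n} (h : PhiSupport k n i q p) :
    p (genSnd i) = !p (genFst i) := by
  have := h.2.2.2.1
  cases hp : p (genFst i) <;> cases hq : p (genSnd i) <;> simp_all

/-- The column-`p` entries of `Φ_i` vanish off the two flips of `p`. [folklore] -/
theorem ajlPhi_apply_eq_zero_of_ne_flipTo {r p : Cryptography.QReg n} (h1 : r ≠ flipTo p i true)
    (h2 : r ≠ flipTo p i false) : ajlPhi k n i r p = 0 := by
  rw [ajlPhi_apply, if_neg]
  intro h
  have e := eq_flipTo_of_agree h.2.2.1 h.2.2.2.2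
  cases hb : r (genFst i)
  · exact h2 (hb ▸ e)
  · exact h1 (hb ▸ e)

/-- The entry `Φ_i(q, p♭) Φ_i(p♭, p)` through the flip `p♭ = flipTo p i b`, in closed form:
`λ_{z+ε(b)} √(λ_{z+ε(p)} λ_{z+ε(q)}) / λ_z²` on the support of `(q, p)`. [cite: AharonovJonesLandau2009, Claim 3.1 (Claim 2.4)] -/
theorem ajlPhi_flipTo_mul (hsupp : ∀ {q p : Cryptography.QReg n}, PhiSupport k n i q p → True) {q p : Cryptography.QReg n}
    (h : PhiSupport k n i q p) (b : Bool) :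
    ajlPhi k n i q (flipTo p i b) * ajlPhi k n i (flipTo p i b) p =
      ajlWeight k (pathPos p i + stepSign b) *
        Real.sqrt (ajlWeight k (pathPos p i + stepSign (p (genFst i))) *
          ajlWeight k (pathPos p i + stepSign (q (genFst i)))) / ajlWeight k (pathPos p i) ^ 2 := by
  have _ := hsupp h
  set z := pathPos p i with hz
  have hzr : pathPos (flipTo p i b) i = z := pathPos_flipTo_of_le p i b le_rfl
  by_cases hr : IsGkPath k n (flipTo p i b)
  · -- both factors are on the support
    have h1 : PhiSupport k n i (flipTo p i b) p :=
      ⟨h.1, hr, fun t h1 h2 => flipTo_of_ne p i b h1 h2, h.2.2.2.1, by simp⟩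
    have h2 : PhiSupport k n i q (flipTo p i b) :=
      ⟨hr, h.2.1, fun t h1 h2 => by rw [flipTo_of_ne p i b h1 h2, h.2.2.1 t h1 h2], by simp,
        h.2.2.2.2⟩
    rw [ajlPhi_apply, if_pos h2, ajlPhi_apply, if_pos h1, hzr, flipTo_genFst]
    have ha := ajlWeight_nonneg k (z + stepSign b)
    have hb' := ajlWeight_nonneg k (z + stepSign (p (genFst i)))
    have hc := ajlWeight_nonneg k (z + stepSign (q (genFst i)))
    rw [div_mul_div_comm, ← sq, ← Real.sqrt_mul (mul_nonneg ha hc),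
      show ajlWeight k (z + stepSign b) * ajlWeight k (z + stepSign (q (genFst i))) *
          (ajlWeight k (z + stepSign (p (genFst i))) * ajlWeight k (z + stepSign b)) =
        ajlWeight k (z + stepSign b) ^ 2 *
          (ajlWeight k (z + stepSign (p (genFst i))) * ajlWeight k (z + stepSign (q (genFst i))))
        by ring,
      Real.sqrt_mul (sq_nonneg _), Real.sqrt_sq ha]
  · -- the flip is not a walk: both sides vanish
    have h0 : ajlWeight k (z + stepSign b) = 0 :=
      ajlWeight_eq_zero_of_not_isGkPath_flipTo h.1 h.snd_eq hr
    rw [h0, zero_mul, zero_div, ajlPhi_apply, if_neg, zero_mul]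
    exact fun h' => hr h'.1

/-- **AJL Claim 3.1 (with Claim 2.4): `Φ_i² = d Φ_i`**, `d = 2cos(π/k)`, from the eigenvector
identity `λ_{z-1} + λ_{z+1} = d λ_z`. [cite: AharonovJonesLandau2009, Claim 3.1 (Claim 2.4, Claim 2.6)] -/
theorem ajlPhi_mul_self (k n : ℕ) (i : Fin (n - 1)) :
    ajlPhi k n i * ajlPhi k n i = ajlLoopValue k • ajlPhi k n i := by
  ext q p
  rw [Matrix.mul_apply, Matrix.smul_apply, smul_eq_mul,
    Fintype.sum_eq_add (flipTo p i true) (flipTo p i false) (flipTo_true_ne_false p i)]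
  swap
  · rintro r ⟨h1, h2⟩
    rw [ajlPhi_apply_eq_zero_of_ne_flipTo h1 h2, mul_zero]
  by_cases h : PhiSupport k n i q p
  · rw [ajlPhi_flipTo_mul (fun _ => trivial) h, ajlPhi_flipTo_mul (fun _ => trivial) h,
      ajlPhi_apply, if_pos h]
    have hi : (i : ℕ) ≤ n := by omega
    have hz := h.1.bounds hi
    have hzpos := ajlWeight_pos hz
    have key := ajlWeight_pred_add_succ hz
    simp only [stepSign_true, stepSign_false, ← sub_eq_add_neg]
    rw [← add_div, ← add_mul, add_comm (ajlWeight k (pathPos p i + 1)), key]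
    field_simp
  · rw [ajlPhi_apply k n i q p, if_neg h, mul_zero]
    -- each summand vanishes
    have hv : ∀ b, ajlPhi k n i q (flipTo p i b) * ajlPhi k n i (flipTo p i b) p = 0 := by
      intro b
      by_cases hp : PhiSupport k n i (flipTo p i b) p
      · by_cases hq : PhiSupport k n i q (flipTo p i b)
        · exact absurd ⟨hp.1, hq.2.1, fun t h1 h2 => by rw [hq.2.2.1 t h1 h2, hp.2.2.1 t h1 h2],
            hp.2.2.2.1, hq.2.2.2.2⟩ h
        · rw [ajlPhi_apply k n i q, if_neg hq, zero_mul]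
      · rw [ajlPhi_apply k n i _ p, if_neg hp, mul_zero]
    rw [hv, hv, add_zero]

/-- `Φ_i` as a complex matrix. [cite: AharonovJonesLandau2009, §3.1] -/
abbrev ajlPhiC (k n : ℕ) (i : Fin (n - 1)) : Matrix (Cryptography.QReg n) (Cryptography.QReg n) ℂ :=
  (ajlPhi k n i).map ((↑) : ℝ → ℂ)

/-- `Φ_i² = d Φ_i` over `ℂ`. [cite: AharonovJonesLandau2009, Claim 3.1] -/
theorem ajlPhiC_mul_self (k n : ℕ) (i : Fin (n - 1)) :
    ajlPhiC k n i * ajlPhiC k n i = (ajlLoopValue k : ℂ) • ajlPhiC k n i := by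
  ext q p
  have := congr_fun (congr_fun (ajlPhi_mul_self k n i) q) p
  rw [Matrix.mul_apply, Matrix.smul_apply, smul_eq_mul] at this
  simp only [Matrix.mul_apply, Matrix.map_apply, Matrix.smul_apply, smul_eq_mul]
  exact_mod_cast this

/-- `Φ_i` is Hermitian over `ℂ` (real symmetric). [cite: AharonovJonesLandau2009, Claim 3.1] -/
theorem ajlPhiC_conjTranspose (k n : ℕ) (i : Fin (n - 1)) : (ajlPhiC k n i)ᴴ = ajlPhiC k n i := by
  ext q p
  have e : ajlPhi k n i p q = ajlPhi k n i q p := by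
    rw [← transpose_apply (ajlPhi k n i) q p, ajlPhi_transpose]
  change star ((ajlPhi k n i p q : ℝ) : ℂ) = ((ajlPhi k n i q p : ℝ) : ℂ)
  rw [Complex.star_def, Complex.conj_ofReal, e]

end Claim31

/-! ### Claim 2.2: unitarity of the crossing matrices -/

section Unitary

/-- **AJL Claim 2.2 (the computation, for any Hermitian `Φ` with `Φ² = dΦ`):** the matrix
`ρ_A(σ^{±1}) = A^{±1} Φ + A^{∓1} 1` is unitary, because `|A_k| = 1` and `d = -A_k² - A_k⁻²`:
`(cΦ + c'1)(c̄Φ + c̄'1) = (|c|²d + c c̄' + c' c̄)Φ + |c'|² 1 = (d + A² + A⁻²)Φ + 1 = 1`.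
[cite: AharonovJonesLandau2009, Claim 2.2] -/
theorem crossing_mem_unitaryGroup_of_sq {ι : Type*} [Fintype ι] [DecidableEq ι] (k : ℕ)
    {Φ : Matrix ι ι ℂ} (hH : Φᴴ = Φ) (hsq : Φ * Φ = (ajlLoopValue k : ℂ) • Φ) (positive : Bool) :
    crossingWeight (ajlPoint k) positive true • Φ + crossingWeight (ajlPoint k) positive false • 1 ∈
      Matrix.unitaryGroup ι ℂ := by
  have hd : (ajlLoopValue k : ℂ) = -ajlPoint k ^ 2 - (ajlPoint k)⁻¹ ^ 2 := by
    rw [← loopValue_ajlPoint]; rfl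
  have hA0 : ajlPoint k ≠ 0 := ajlPoint_ne_zero k
  have hAc : starRingEnd ℂ (ajlPoint k) = (ajlPoint k)⁻¹ := (ajlPoint_inv k).symm
  have hAc' : starRingEnd ℂ (ajlPoint k)⁻¹ = ajlPoint k := by rw [map_inv₀, hAc, inv_inv]
  -- the generic computation of Claim 2.2
  have key : ∀ c c' : ℂ,
      starRingEnd ℂ c * c * (ajlLoopValue k : ℂ) + starRingEnd ℂ c' * c + starRingEnd ℂ c * c' = 0 →
      starRingEnd ℂ c' * c' = 1 →
      (c • Φ + c' • (1 : Matrix ι ι ℂ)) * star (c • Φ + c' • (1 : Matrix ι ι ℂ)) = 1 := by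
    intro c c' h1 h2
    have hstar : star (c • Φ + c' • (1 : Matrix ι ι ℂ)) = starRingEnd ℂ c • Φ + starRingEnd ℂ c' • 1 := by
      rw [star_eq_conjTranspose, conjTranspose_add, conjTranspose_smul, conjTranspose_smul, hH,
        conjTranspose_one]
      rfl
    rw [hstar, add_mul, mul_add, mul_add]
    simp only [Matrix.smul_mul, Matrix.mul_smul, Matrix.one_mul, Matrix.mul_one, smul_smul]
    rw [hsq, smul_smul, ← add_assoc, ← add_smul, ← add_smul, h1, zero_smul, zero_add, h2, one_smul]
  set A := ajlPoint k with hA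
  have s1 : starRingEnd ℂ A * A * (ajlLoopValue k : ℂ) + starRingEnd ℂ A⁻¹ * A +
      starRingEnd ℂ A * A⁻¹ = 0 := by
    rw [hAc', hAc, hd]; field_simp; ring
  have s1' : starRingEnd ℂ A⁻¹ * A⁻¹ * (ajlLoopValue k : ℂ) + starRingEnd ℂ A * A⁻¹ +
      starRingEnd ℂ A⁻¹ * A = 0 := by
    rw [hAc', hAc, hd]; field_simp; ring
  have s2 : starRingEnd ℂ A⁻¹ * A⁻¹ = 1 := by rw [hAc', mul_inv_cancel₀ hA0]
  have s2' : starRingEnd ℂ A * A = 1 := by rw [hAc, inv_mul_cancel₀ hA0]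
  rw [Matrix.mem_unitaryGroup_iff]
  cases positive
  · simpa [crossingWeight] using key A⁻¹ A s1' s2'
  · simpa [crossingWeight] using key A A⁻¹ s1 s2

/-- **AJL Claims 2.2 and 3.1: the crossing matrices `A_k^{±1} Φ_i + A_k^{∓1} 1` are unitary** on
the whole `n`-qubit register (zero extension of `Φ_i` off `P_{n,k}`; no hypothesis on `k`).
[cite: AharonovJonesLandau2009, Claim 2.2 and Claim 3.1] -/
theorem ajlCrossingMatrix_mem_unitaryGroup (k n : ℕ) (g : Fin (n - 1) × Bool) :
    ajlCrossingMatrix k g ∈ Matrix.unitaryGroup (Cryptography.QReg n) ℂ :=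
  crossing_mem_unitaryGroup_of_sq k (ajlPhiC_conjTranspose k n g.1) (ajlPhiC_mul_self k n g.1) g.2

/-- The braid-word matrix is the ordered product over the word. [cite: AharonovJonesLandau2009, Cor. 3.1] -/
theorem ajlBraidMatrix_eq (k : ℕ) (b : BraidWord n) :
    ajlBraidMatrix k b = (b.map (ajlCrossingMatrix k)).prod := by
  rw [ajlBraidMatrix, ajlBraidMatrixFn,
    show (fun j => ajlCrossingMatrix k (b.get j)) = ajlCrossingMatrix k ∘ b.get from rfl,
    ← List.map_ofFn, List.ofFn_get]

/-- **`φ(w)` is unitary** (Claim 3.1: "`Φ` induces a unitary representation of `B_n`").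
[cite: AharonovJonesLandau2009, Claim 3.1 and Cor. 3.1] -/
theorem ajlBraidMatrixFn_mem_unitaryGroup (k : ℕ) {m : ℕ} (w : Fin m → Fin (n - 1) × Bool) :
    ajlBraidMatrixFn k w ∈ Matrix.unitaryGroup (Cryptography.QReg n) ℂ := by
  rw [ajlBraidMatrixFn]
  refine list_prod_mem ?_
  intro M hM
  rw [List.mem_ofFn] at hM
  obtain ⟨j, rfl⟩ := hM
  exact ajlCrossingMatrix_mem_unitaryGroup k n (w j)

/-- `φ(b)` is unitary for every braid word `b`. [cite: AharonovJonesLandau2009, Claim 3.1 and Cor. 3.1] -/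
theorem ajlBraidMatrix_mem_unitaryGroup (k : ℕ) (b : BraidWord n) :
    ajlBraidMatrix k b ∈ Matrix.unitaryGroup (Cryptography.QReg n) ℂ :=
  ajlBraidMatrixFn_mem_unitaryGroup k b.get

/-- Hence `|⟨α|φ(w)|α⟩| ≤ 1` (and likewise for every entry). [cite: AharonovJonesLandau2009, §3.3] -/
theorem norm_ajlBraidMatrixFn_apply_le_one (k : ℕ) {m : ℕ} (w : Fin m → Fin (n - 1) × Bool)
    (q p : Cryptography.QReg n) : ‖ajlBraidMatrixFn k w q p‖ ≤ 1 :=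
  entry_norm_bound_of_unitary (ajlBraidMatrixFn_mem_unitaryGroup k w) q p

end Unitary

/-! ### Claim 3.8: `Φ₀ Φ₂ ⋯ Φ_{n-2} = d^{n/2} |α⟩⟨α|` -/

section Claim38

variable {k : ℕ}

/-- `S_l`: walks of `P_{n,k}` whose first `2l` bits are `1,0,1,0,…` (the zigzag `1,2,1,2,…`).
[cite: AharonovJonesLandau2009, Claim 3.8 (proof)] -/
def AltPrefix (k n l : ℕ) (p : Cryptography.QReg n) : Prop :=
  IsGkPath k n p ∧ ∀ t : Fin n, (t : ℕ) < 2 * l → p t = decide (Even (t : ℕ))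

/-- Membership in `S_l` is decidable. [folklore] -/
instance (k n l : ℕ) : DecidablePred (AltPrefix k n l) := fun _ => by
  unfold AltPrefix; infer_instance

/-- The diagonal projection onto `S_l`. [cite: AharonovJonesLandau2009, Claim 3.8 (proof)] -/
def altDiag (k n l : ℕ) : Matrix (Cryptography.QReg n) (Cryptography.QReg n) ℝ :=
  Matrix.of fun q p => if q = p ∧ AltPrefix k n l p then 1 else 0

/-- After a zigzag prefix of length `2l` the walk is back at vertex `1`. [cite: AharonovJonesLandau2009, Claim 3.8 (proof)] -/
theorem pathPos_of_altPrefix {p : Cryptography.QReg n} {l : ℕ}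
    (h : ∀ t : Fin n, (t : ℕ) < 2 * l → p t = decide (Even (t : ℕ))) (hl : 2 * l ≤ n) :
    pathPos p (2 * l) = 1 := by
  induction l with
  | zero => simp
  | succ l ih =>
    have h1 : 2 * l < n := by omega
    have h2 : 2 * l + 1 < n := by omega
    rw [show 2 * (l + 1) = 2 * l + 1 + 1 by ring, pathPos_succ p h2, pathPos_succ p h1,
      ih (fun t ht => h t (by omega)) (by omega), h ⟨2 * l, h1⟩ (by show 2 * l < 2 * (l + 1); omega),
      h ⟨2 * l + 1, h2⟩ (by show 2 * l + 1 < 2 * (l + 1); omega)]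
    simp

/-- A walk of `P_{n,k}` at vertex `1` must step to the right. [cite: AharonovJonesLandau2009, §3.1] -/
theorem eq_true_of_isGkPath {p : Cryptography.QReg n} (hp : IsGkPath k n p) {j : ℕ} (hj : j < n)
    (hz : pathPos p j = 1) : p ⟨j, hj⟩ = true := by
  have hb := (hp (j + 1) hj).1
  rw [pathPos_succ p hj, hz] at hb
  cases h : p ⟨j, hj⟩
  · rw [h] at hb; simp at hb
  · rfl

/-- `λ_2 / λ_1 = d` (the eigenvector identity at the end vertex, `λ_0 = 0`). [cite: AharonovJonesLandau2009, Claim 2.6] -/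
theorem ajlWeight_two_div_one (hk : 3 ≤ k) :
    Real.sqrt (ajlWeight k (1 + 1) * ajlWeight k (1 + 1)) / ajlWeight k 1 = ajlLoopValue k := by
  have h1 : (1 : ℤ) ≤ 1 ∧ (1 : ℤ) + 1 ≤ k := ⟨le_rfl, by omega⟩
  have key := ajlWeight_pred_add_succ h1
  rw [ajlWeight_of_not (by omega), zero_add] at key
  rw [Real.sqrt_mul_self (ajlWeight_nonneg _ _), key, mul_div_assoc,
    div_self (ajlWeight_pos h1).ne', mul_one]

/-- The inductive step of Claim 3.8: `diag(S_l) Φ_{2l} = d · diag(S_{l+1})`.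
[cite: AharonovJonesLandau2009, Claim 3.8 (proof: "`Φ₁` on `p` simply applies the rescaled projection `d|10⟩⟨10|`")] -/
theorem altDiag_mul_ajlPhi (hk : 3 ≤ k) {l : ℕ} (hl : 2 * l + 2 ≤ n) :
    altDiag k n l * ajlPhi k n ⟨2 * l, by omega⟩ = ajlLoopValue k • altDiag k n (l + 1) := by
  set i : Fin (n - 1) := ⟨2 * l, by omega⟩ with hi
  have hfst : genFst i = ⟨2 * l, by omega⟩ := rfl
  have hsnd : genSnd i = ⟨2 * l + 1, by omega⟩ := rfl
  ext q p
  rw [Matrix.mul_apply, Finset.sum_eq_single q]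
  · rw [Matrix.smul_apply, smul_eq_mul]
    simp only [altDiag, of_apply, true_and]
    by_cases hq : AltPrefix k n l q
    · rw [if_pos hq, one_mul, ajlPhi_apply]
      by_cases hs : PhiSupport k n i q p
      · -- the main case: `q = p ∈ S_{l+1}` and the entry is `λ₂/λ₁ = d`
        have hagree : ∀ t : Fin n, (t : ℕ) < 2 * l → p t = q t := fun t ht =>
          (hs.2.2.1 t (fun e => by rw [e, hfst] at ht; simp at ht)
            (fun e => by rw [e, hsnd] at ht; simp at ht)).symm
        have hpalt : ∀ t : Fin n, (t : ℕ) < 2 * l → p t = decide (Even (t : ℕ)) :=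
          fun t ht => (hagree t ht).trans (hq.2 t ht)
        have hzp : pathPos p (2 * l) = 1 := pathPos_of_altPrefix hpalt (by omega)
        have hzq : pathPos q (2 * l) = 1 := pathPos_of_altPrefix hq.2 (by omega)
        have hp0 : p (genFst i) = true := eq_true_of_isGkPath hs.1 (by omega) hzp
        have hq0 : q (genFst i) = true := eq_true_of_isGkPath hs.2.1 (by omega) hzq
        have hp1 : p (genSnd i) = false := by rw [hs.snd_eq, hp0]; rfl
        have hq1 : q (genSnd i) = false := by rw [hs.symm.snd_eq, hq0]; rfl
        have hqp : q = p := by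
          funext t
          by_cases h1 : t = genFst i
          · rw [h1, hp0, hq0]
          · by_cases h2 : t = genSnd i
            · rw [h2, hp1, hq1]
            · exact hs.2.2.1 t h1 h2
        have hp' : AltPrefix k n (l + 1) p := by
          refine ⟨hs.1, fun t ht => ?_⟩
          rcases Nat.lt_or_ge t (2 * l) with h | h
          · exact hpalt t h
          · rcases Nat.lt_or_ge t (2 * l + 1) with h' | h'
            · have : t = genFst i := Fin.ext (by show (t : ℕ) = 2 * l; omega)
              rw [this, hp0, hfst]; simp
            · have : t = genSnd i := Fin.ext (by show (t : ℕ) = 2 * l + 1; omega)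
              rw [this, hp1, hsnd]; simp
        rw [if_pos hs, if_pos ⟨hqp, hp'⟩, mul_one, show ((i : Fin (n - 1)) : ℕ) = 2 * l from rfl,
          hzp, hp0, hq0, stepSign_true, ajlWeight_two_div_one hk]
      · rw [if_neg hs, if_neg]
        · simp
        rintro ⟨rfl, hp'⟩
        refine hs ⟨hp'.1, hp'.1, fun t _ _ => rfl, ?_, ?_⟩ <;>
        · rw [hfst, hsnd, hp'.2 ⟨2 * l, _⟩ (by show 2 * l < 2 * (l + 1); omega),
            hp'.2 ⟨2 * l + 1, _⟩ (by show 2 * l + 1 < 2 * (l + 1); omega)]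
          simp
    · rw [if_neg hq, zero_mul, if_neg]
      · simp
      rintro ⟨rfl, hp'⟩
      exact hq ⟨hp'.1, fun t ht => hp'.2 t (by omega)⟩
  · intro r _ hr
    simp [altDiag, Ne.symm hr]
  · simp

/-- The base of Claim 3.8: the rows of `Φ₀` are supported on `P_{n,k} = S_0`. [cite: AharonovJonesLandau2009, Claim 3.8 (proof)] -/
theorem altDiag_zero_mul_ajlPhi (i : Fin (n - 1)) : altDiag k n 0 * ajlPhi k n i = ajlPhi k n i := by
  ext q p
  rw [Matrix.mul_apply, Finset.sum_eq_single q]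
  · simp only [altDiag, of_apply, true_and]
    by_cases hq : AltPrefix k n 0 q
    · rw [if_pos hq, one_mul]
    · rw [if_neg hq, zero_mul, ajlPhi_apply, if_neg]
      exact fun hs => hq ⟨hs.2.1, fun t ht => by omega⟩
  · intro r _ hr
    simp [altDiag, Ne.symm hr]
  · simp

/-- Claim 3.8 for the first `h ≥ 1` factors: `Φ₀ Φ₂ ⋯ Φ_{2h-2} = d^h · diag(S_h)`.
[cite: AharonovJonesLandau2009, Claim 3.8 (proof, "by induction")] -/
theorem prod_ajlPhi_even (hk : 3 ≤ k) {h : ℕ} (h1 : 1 ≤ h) (hh : 2 * h ≤ n) :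
    (List.ofFn fun l : Fin h => ajlPhi k n ⟨2 * (l : ℕ), by omega⟩).prod =
      ajlLoopValue k ^ h • altDiag k n h := by
  induction h with
  | zero => omega
  | succ h ih =>
    rw [List.ofFn_succ', List.prod_concat]
    simp only [Fin.val_castSucc, Fin.val_last]
    rcases Nat.eq_zero_or_pos h with rfl | hpos
    · simp only [List.ofFn_zero, List.prod_nil, Nat.mul_zero]
      rw [← altDiag_zero_mul_ajlPhi, altDiag_mul_ajlPhi hk (by omega)]
      simp
    · rw [ih hpos (by omega), Matrix.smul_mul, altDiag_mul_ajlPhi hk (by omega), smul_smul,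
        pow_succ]

/-- The zigzag string `α` is a walk of `P_{n,k}` (`k ≥ 3`: it only visits the vertices `1, 2`).
[cite: AharonovJonesLandau2009, §3.3] -/
theorem isGkPath_ajlAlpha (hk : 3 ≤ k) (n : ℕ) : IsGkPath k n (ajlAlpha n) := by
  intro j hj
  have halt : ∀ l, 2 * l ≤ n → pathPos (ajlAlpha n) (2 * l) = 1 := fun l hl =>
    pathPos_of_altPrefix (fun t _ => rfl) hl
  obtain ⟨l, rfl | rfl⟩ := Nat.even_or_odd' j
  · rw [halt l hj]; omega
  · rw [pathPos_succ _ (by omega), halt l (by omega)]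
    simp [ajlAlpha]
    omega

/-- `S_{n/2} = {α}` for even `n`. [cite: AharonovJonesLandau2009, Claim 3.8 (proof)] -/
theorem altPrefix_half_iff (hk : 3 ≤ k) (hn : Even n) (p : Cryptography.QReg n) :
    AltPrefix k n (n / 2) p ↔ p = ajlAlpha n := by
  constructor
  · rintro ⟨-, h⟩
    funext t
    exact h t (by have := t.2; obtain ⟨r, hr⟩ := hn; omega)
  · rintro rfl
    exact ⟨isGkPath_ajlAlpha hk n, fun t _ => rfl⟩

/-- **AJL Claim 3.8** (0-indexed): for even `n`, `Φ₀ Φ₂ ⋯ Φ_{n-2} = d^{n/2} |α⟩⟨α|` on the whole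
register. [cite: AharonovJonesLandau2009, Claim 3.8] -/
theorem ajl_claim38 (k n : ℕ) (hk : 3 ≤ k) (hn : Even n) :
    ((List.finRange (n / 2)).map fun l : Fin (n / 2) =>
        ajlPhi k n ⟨2 * (l : ℕ), by have := l.2; omega⟩).prod =
      ajlLoopValue k ^ (n / 2) • ajlAlphaProj n := by
  rcases Nat.eq_zero_or_pos (n / 2) with h0 | hpos
  · -- `n = 0`: empty product, and `|α⟩⟨α| = 1` on the one-point register
    have hn0 : n = 0 := by obtain ⟨r, hr⟩ := hn; omega
    subst hn0
    simp only [Nat.zero_div, pow_zero, one_smul]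
    ext q p
    rw [Subsingleton.elim q (ajlAlpha 0), Subsingleton.elim p (ajlAlpha 0)]
    simp [ajlAlphaProj]
  · rw [← List.ofFn_eq_map, prod_ajlPhi_even hk hpos (Nat.mul_div_le n 2)]
    congr 1
    ext q p
    simp only [altDiag, ajlAlphaProj, of_apply, altPrefix_half_iff hk hn]
    by_cases hp : p = ajlAlpha n
    · subst hp; simp
    · simp [hp]

end Claim38

/-! ### Consequences of the matrix-element identity for the tree's `ajlRatio` -/

section Ratio

/-- `d = 2cos(π/k) > 0` for `k ≥ 3`. [cite: AharonovJonesLandau2009, Claim 2.6] -/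
theorem ajlLoopValue_pos {k : ℕ} (hk : 3 ≤ k) : 0 < ajlLoopValue k := by
  rw [ajlLoopValue]
  have hk' : (3 : ℝ) ≤ k := by exact_mod_cast hk
  have h1 : Real.pi / k ≤ Real.pi / 3 := by
    apply div_le_div_of_nonneg_left Real.pi_pos.le (by norm_num) hk'
  have h2 : 0 < Real.cos (Real.pi / k) := by
    apply Real.cos_pos_of_mem_Ioo
    constructor
    · have : 0 < Real.pi / k := by positivity
      linarith
    · linarith [Real.pi_pos]
  linarith

/-- **Given the identity of Thm. 3.2, the tree's normalised Jones modulus is the modulus of the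
`(α, α)` entry of the unitary `φ(b)`:** `ajlRatio k n b = |⟨α|φ(b)|α⟩|`.
[cite: AharonovJonesLandau2009, Thm. 3.2 and §3.3] -/
theorem ajlRatio_eq_norm_of_thm32 (h : ajl_thm32_matrixElement) {k n : ℕ} (hk : 3 ≤ k)
    (hn : Even n) (h2 : 2 ≤ n) (b : BraidWord n) :
    ajlRatio k n b = ‖ajlBraidMatrix k b (ajlAlpha n) (ajlAlpha n)‖ := by
  rw [ajlBraidMatrix, h k n b.length b.get hk hn h2, norm_div, norm_pow, Complex.norm_real,
    Real.norm_of_nonneg (ajlLoopValue_pos hk).le, ajlRatio, jonesPlatModulus]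

/-- Hence, given Thm. 3.2, `0 ≤ ajlRatio k n b ≤ 1`: the promise thresholds of
`jonesApproxProblem` live in `[0, 1]`. [cite: AharonovJonesLandau2009, Thm. 3.2 and §3.3] -/
theorem ajlRatio_le_one_of_thm32 (h : ajl_thm32_matrixElement) {k n : ℕ} (hk : 3 ≤ k)
    (hn : Even n) (h2 : 2 ≤ n) (b : BraidWord n) : ajlRatio k n b ≤ 1 := by
  rw [ajlRatio_eq_norm_of_thm32 h hk hn h2 b, ajlBraidMatrix]
  exact norm_ajlBraidMatrixFn_apply_le_one k b.get _ _

end Ratio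

end Literature.Computability.QuantumComplexity

end
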